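import Literature.IUT.HodgeArakelov.TemperedFrobenioidDataOfBTemp
import Literature.IUT.HodgeArakelov.ModelCyclotomesZHat
import Literature.AnabelianGeometry.EtaleTheta.Discharge.Sec2Prop214iiOfOrigin
import Literature.AnabelianGeometry.EtaleTheta.Discharge.Sec5Thm510iiiOfThetaSettingYdd

/-!
# [IUTchII] §1, Proposition 1.2 (ii) END TO END for the GENUINE Frobenioid-theoretic mono-theta environment `E^Π_N` of the Tate curve's
# [EtTh] §5 data — the binder `hM` ([EtTh] Lemma 5.9 (iv)) DISCHARGED at abc-iut-L2's Ÿ̲̲-junction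

S. Mochizuki, *Inter-universal Teichmüller theory II*, §1, Proposition 1.2 (ii), kurims manuscript (Dec. 2020) pp. 25–26
[claim: Mochizuki2012, status: disputed] (IUTchII §1 Prop 1.2 (ii), kurims pp.25-26): "Let `𝒞` be a category equivalent to the tempered Frobenioid
determined by `X̲̲_k` […]. Then there exists a functorial algorithm `𝒞 ↦ M^Θ(𝒞)` for constructing from the category `𝒞` a mod `N` mono-theta
environment [cf. [EtTh], Theorem 5.10, (iii)] such that the composite of this algorithm with the algorithm `M^Θ(𝒞) ↦ Π_X(M^Θ(𝒞))` discussed in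
Definition 1.1, (i), admits a functorial isomorphism `𝒟 ⥲ B^temp(Π_X(M^Θ(𝒞)))⁰`."  Printed proof (p. 26): "The assertions of Proposition 1.2
follow immediately from the results of [EtTh] that are quoted in the statements of these assertions."  [EtTh] inputs: Lemma 5.9 (iv) p.332
(PDF p.106), Prop. 5.2 (iii) p.324 (PDF p.98), Cor. 2.18 (ii), (iv) p.286–287 (PDF pp.60–61) [cite: MochizukiEtTh2009, Lem 5.9 (iv) p.332 (PDF p.106)].

abc-iut cell, DAG node `IUTchII:Prop1.2(ii)` (cone of [IUTchIII] Cor. 3.12); seat abc-iut-L2-t11 (gen 7), row «THM510iii-HM-KNIT» of abc-iut-L6-lead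
(gen 6, 2026-08-26T17:51:34Z (4): "a STRICT binder reduction for a named L6 consumer").  PROOF-ONLY (0 definitions, 0 new `Prop` facts, no `instance`;
nothing landed is edited or restated).  THE CONSUMER: abc-iut-w5-d177's `exists_envOfFrobenioid_frdMonoThetaEnv` (`TemperedFrobenioidDataOfBTemp.lean`,
one application of abc-iut-w4-d008's `exists_envOfFrobenioid_of_isMonoThetaEnv`, `MonoThetaFromGroupsProofsTate.lean` p412730) — Prop. 1.2 (ii) END
TO END with `M^Θ(𝒞) := E^Π_N`, displaying the binders {`F : ModelFrame S R`, `A : ModelAgreement S R.toThetaEnvData`, `h218ii : Cor218_ii` (F-0635),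
`hfib : Cor218_iv_fibre` (F-0638/F-0624), `𝔉`, `h1 h3 hsec hcs h8`, `DK`, `hM : IsMonoThetaEnv (E^Π_N)` (F-0546 instance form), `e`/`Fr`}.

THIS FILE, at the [IUTchII] §1 setting OF THE TATE CURVE `ThetaSetting.ofDoubleUnderline C μ hC hS hl hp2 hpl hζ hη` (abc-iut-L6-d6, bridge B8 part 3;
the setting BUILT from abc-iut-L2-t8's `C.thetaEnvData μ hC hS`, reference model := abc-iut-L2-t2's `modelMono η`) with `R :=` abc-iut-L2-t8's REAL
rigidity data `C.rigidData μ hC hS h15 L` (`toThetaEnvData = C.thetaEnvData μ hC hS` by `rfl`) and `𝔉 :=` abc-iut-L2-t4's §5 data OF THE SETTING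
`ThetaFrobenioid.ofThetaSettingData μ hC hS h Q R' K' constEmb …` over `BiKummerSetting.mkOfThetaSettingYdd` (`A_⊙^bs := Ÿ̲̲`) at the honest `K^×`-part
`DK := dkOfConnectedTemperoidData … = kummerOut` — EVERY ONE of those binders is SUPPLIED BY NAME:
* `F` := abc-iut-L6-d6's `modelFrameOfThetaEnvData` with `t1Space_Huu`, `isClosed_ker_aug_thetaEnvData` (PROVED, `ModelDef11Output.lean`) and
  `(l·Δ_Θ)/thetaKer ≅ Ẑ` := bridge B8 part 5a's `ModelCyclotomes.nonempty_lDeltaQuot_rigidData_mulEquiv_zHat` (`ModelCyclotomesZHat.lean`;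
  ⟸ {`IsEtThOrigin`, `hYcl`});
* `A` := `modelAgreement_ofThetaEnvData` (unconditional, bridge B8 part 2);
* `h218ii` := abc-iut-L2's `rigidData_cor218_ii_of_origin` (Cor. 2.18 (ii) for the §1 model ⟸ {`Prop15iii`, `Prop15ii`, `IsEtThOrigin`}, read through
  `RigidData.cor218_ii_iff = Iff.rfl`);
* `hfib` := abc-iut-L2's `rigidData_cor218_iv_fibre_of_origin` (Cor. 2.18 (iv), fibres, ⟸ {`IsEtThOrigin`, `hYcl`}) — exactly as this file's sibling
  `exists_envOfFrobenioid_indeterminacy_ofDoubleUnderline` (abc-iut-w4-d008) already does for an ABSTRACT `M`;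
* `hM` := abc-iut-L2-t11's `ThetaFrobenioid.frdIsMonoThetaEnv_ofThetaSettingYdd_of_originClause` (`Discharge/Sec5Thm510iiiOfThetaSettingYdd.lean`,
  p462036: [EtTh] Lemma 5.9 (iv) "In particular" for the §5 data of the Setting at the honest `DK`, ⟸ {Def. 3.6 (iii)'s `hconst`, the ONE
  constants-dictionary binder `hD`, a cyclotome reading `m`, the Prop. 5.2 (iii) ORIGIN CLAUSE `hΘ` (GAP G-L2t4-2)} — the bundle `Facts` being a
  THEOREM there ⟸ {`hconst`, `hD`});
* `h1 h3 hsec hcs h8` are ARBITRARY proofs of the five `Prop`-valued §5 laws through which `E^Π_N` is DEFINED (proof-irrelevant; the `_canonical`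
  form displays none: `h3 :=` abc-iut-L2-t4's theorem `outerActionLZ_of`, the rest := fields of `Facts` ⟸ {`hconst`, `hD`}).
BINDERS BEFORE (consumer) → AFTER (here): {F, A, h218ii, hfib, hM, h1, h3, hsec, hcs, h8, DK, 𝔉, e} → {the printed [IUTchII] §1 side conditions
`hl hp2 hpl hζ` and the model's cocycle `η, hη` (as every Tate-curve closer of this directory), abc-iut-L2-t1's named facts `Prop15iii` (`h15`) /
`Prop15ii` (`h15ii`), `L : CuspLabels`, the guard `IsEtThOrigin` (`hO`), the closedness binder `hYcl` of the §2 rigidity chain; the junction data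
(`tf`, `h`, `Q`, roots `R'`, `K'`, `constEmb`, `hinvc`, `hinvp`), `hconst`, `hD`, `m`, the origin clause `hΘ`; `Fr`}.  Conclusion for EVERY instance
`Fr : TemperedFrobenioidData (ofDoubleUnderline …)` of abc-iut-L6-t1's interface, and (`_bTemp0`) for w5-d177's LITERAL binder-free instance `ofBTemp0`
OF THE §5 DATA OF THE SETTING ITSELF (its base category IS `BTemp0 (ofDoubleUnderline …).PiX` definitionally):
an `Env : EnvOfFrobenioid Fr` whose `M^Θ(𝒞)` has underlying [EtTh] datum EXACTLY `E^Π_N` of the §5 data of the Setting and whose Def. 1.1 (i) output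
has the Prop. 1.2 (i) isomorphism indeterminacy.
HONEST FRAMING: a kernel-checked composition of landed theorems; `tf` (the tempered Frobenioid of the actual curve) is an abstract parameter, NOT
inhabited in the tree; `Prop15iii`/`Prop15ii` are named (unproved) facts of [EtTh] §1 consumed as hypotheses; nothing disputed is asserted; no side is
taken on [IUTchIII] Cor. 3.12; nothing here asserts that abc is proved or refuted; typed ≠ proved.
-/

noncomputable section

namespace Literature.IUT.HodgeArakelov

open CategoryTheory Opposite Literature.AnabelianGeometry.EtaleTheta Literature.AnabelianGeometry.SemiGraphs
  Literature.AlgebraicGeometry.Frobenioids Literature.AnabelianGeometry.SemiGraphs.GaloisObjects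
  Literature.AlgebraicGeometry.Frobenioids.QuasiTemperoid.BTempConnected
open scoped Literature.AnabelianGeometry.EtaleTheta

universe v₀

namespace ThetaSetting

section TateFrobenioid

variable {p : ℕ} [Fact p.Prime] {D : Literature.AnabelianGeometry.EtaleTheta.ThetaSetting p}
  {E : D.EtaleThetaData} {l : ℕ} (C : E.DoubleUnderline l) {e : D.toTemperedCurve.GroupLevelData} {N : ℕ+}
  (μ : D.CyclotomeMod l N) (hC : D.Compat) (hS : D.Sec2Hyps)
  -- the [IUTchII] §1 side data and the inputs of the frame (as in every Tate-curve closer of this directory)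
  (h15 : Literature.AnabelianGeometry.EtaleTheta.ThetaSetting.Prop15iii E hC)
  (h15ii : Literature.AnabelianGeometry.EtaleTheta.ThetaSetting.Prop15ii E.toKummerData hC) (L : C.CuspLabels)
  (hl : l.Prime) (hp2 : p ≠ 2) (hpl : p ≠ l) (hζ : ∃ ζ : D.K, IsPrimitiveRoot ζ (4 * l))
  {η : (C.thetaEnvData μ hC hS).PiYdd → MuN p N} (hη : η ∈ (C.thetaEnvData μ hC hS).thetaCocycles)
  (hO : D.IsEtThOrigin)
  (hYcl : (D.DtpY.map D.toHat.toMonoidHom).topologicalClosure ≤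
    D.DtpY.map D.toHat.toMonoidHom ⊔ (⁅⁅D.DeltaHat, D.DeltaHat⁆, D.DeltaHat⁆).topologicalClosure)
  -- abc-iut-L2-t4's §5 data OF THE SETTING over the Ÿ̲̲-junction (`A_⊙^bs := Ÿ̲̲`)
  {D₀ : Type} [Category.{v₀} D₀] {V : FrdIMonoidStub.{0}} {T₀ : RealifiedDivisorMonoids (D₀ := D₀) V}
  {VD : FrdICatStub.{1, 0, 0} (ConnectedPart (BTemp (C.temperedArithmeticGroup e).Pi))}
  {tf : TemperedFrobenioid T₀ (ConnectedPart (BTemp (C.temperedArithmeticGroup e).Pi)) VD} {hZ : tf.monoidType = MonoidType.Z}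
  {hP : ∀ A : (ConnectedPart (BTemp (C.temperedArithmeticGroup e).Pi))ᵒᵖ, IsPerfect (tf.Φ.carrier A)}
  {NH : Subgroup (Field.absoluteGaloisGroup D.K) → tf.category → ℕ+ → Prop}
  {pullFrac : ∀ {A A' : (BiKummerSetting.mkOfThetaSettingYdd C e μ hC hS tf hZ hP NH).C} (_ : A' ⟶ A),
    (BiKummerSetting.mkOfThetaSettingYdd C e μ hC hS tf hZ hP NH).biratUnits A →
      (BiKummerSetting.mkOfThetaSettingYdd C e μ hC hS tf hZ hP NH).biratUnits A'}
  {θ : (BiKummerSetting.mkOfThetaSettingYdd C e μ hC hS tf hZ hP NH).biratUnits (BiKummerSetting.mkOfThetaSettingYdd C e μ hC hS tf hZ hP NH).Aodot}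
  {Bl : (BiKummerSetting.mkOfThetaSettingYdd C e μ hC hS tf hZ hP NH).C}
  {Pl : (BiKummerSetting.mkOfThetaSettingYdd C e μ hC hS tf hZ hP NH).FractionPair θ Bl}
  {Rl : (BiKummerSetting.mkOfThetaSettingYdd C e μ hC hS tf hZ hP NH).NthRoot θ Pl C.lPNat pullFrac}
  (h : ModelFrobenioid.Hypotheses tf.divisorMonoid tf.ratFnFunctor)
  (Q : FrobenioidTheta.ThetaSubquotientStub.{0} (ConnectedPart (BTemp (C.temperedArithmeticGroup e).Pi)))
  (R' : (BiKummerSetting.mkOfThetaSettingYdd C e μ hC hS tf hZ hP NH).NthRoot Rl.root Rl.pair N pullFrac)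
  (K' : Type) [Field K'] (constEmb : K'ˣ →* tf.biratUnitsModel R'.BN) (constEmb_injective : Function.Injective constEmb)
  (hinvc : ∀ g : Aut R'.AN.base,
    pull tf.divisorMonoid g.hom (ModelFrobenioid.div R'.pair.num) = ModelFrobenioid.div R'.pair.num)
  (hinvp : ∀ y : (C.thetaEnvData μ hC hS).PiX, y ∈ (C.thetaEnvData μ hC hS).PiYdd →
    pull tf.divisorMonoid ((BiKummerSetting.mkOfThetaSettingYdd C e μ hC hS tf hZ hP NH).galoisSurj
      R'.AN.base R'.αData.isGalois ((ContinuousMulEquiv.refl _) y)).hom (ModelFrobenioid.div R'.pair.den) = ModelFrobenioid.div R'.pair.den)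
  (hconst : ∀ (ε : Aut R'.BN) (k : K'ˣ), tf.biratAutModel R'.BN ε (constEmb k) = constEmb k)
  (m : (ThetaFrobenioid.ofThetaSettingData μ hC hS h Q R' K' constEmb constEmb_injective hinvc hinvp).muTorsion
      (ThetaFrobenioid.ofThetaSettingData μ hC hS h Q R' K' constEmb constEmb_injective hinvc hinvp).BN N ≃* (C.thetaEnvData μ hC hS).mu)
  {Cst : Subgroup ((ThetaFrobenioid.ofThetaSettingData μ hC hS h Q R' K' constEmb constEmb_injective hinvc hinvp).biratUnits
      (ThetaFrobenioid.ofThetaSettingData μ hC hS h Q R' K' constEmb constEmb_injective hinvc hinvp).BN)}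
  {ν' : Cst →* (PadicAlgCl p)ˣ}
  (hD : ThetaFrobenioid.BiratAutAction.ConstantsDictionary
    (ThetaFrobenioid.biratAutAction_ofConnectedTemperoidData (T := C.thetaEnvData μ hC hS) h Q C.odd_lPNat R' (ContinuousMulEquiv.refl _) K'
      constEmb constEmb_injective hinvc hinvp hconst) C μ hC hS (ContinuousMulEquiv.refl _) m Cst ν')
  (hΘ : (fun k : (C.thetaEnvData μ hC hS).PiYdd =>
      (m ((ThetaFrobenioid.ofThetaSettingData μ hC hS h Q R' K' constEmb constEmb_injective hinvc hinvp).diffCocycle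
        (ThetaFrobenioid.facts_ofThetaSettingYddData_of_constantsDictionary (hD' := hD)) k))⁻¹) ∈ C.thetaCocycles hC μ)

include h15 h15ii L hO hYcl hD hΘ

/-- **[IUTchII] Prop. 1.2 (ii) END TO END for the GENUINE `M^Θ(𝒞) := E^Π_N` of the Tate curve's [EtTh] §5 data, `hM` DISCHARGED**: for every
instance `Fr` of abc-iut-L6-t1's interface `TemperedFrobenioidData` over the [IUTchII] §1 setting `ofDoubleUnderline C μ hC hS hl hp2 hpl hζ hη`, and for
ARBITRARY proofs `h1 h3 hsec hcs h8` of the five §5 laws through which abc-iut-L2-t4 defines `E^Π_N` (proof-irrelevant), there is an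
`Env : EnvOfFrobenioid Fr` whose mono-theta environment has underlying [EtTh] datum EXACTLY
`E^Π_N = (ofThetaSettingData …).frdMonoThetaEnv h1 h3 hsec hcs h8 DK` (the §5 data OF THE SETTING over the Ÿ̲̲-junction, honest `DK = kummerOut`) and
whose Def. 1.1 (i) output has the Prop. 1.2 (i) isomorphism indeterminacy.  One application of abc-iut-w4-d008's
`exists_envOfFrobenioid_of_isMonoThetaEnv` with `F`, `A`, `h218ii`, `hfib`, `hM` ALL SUPPLIED BY NAME (module docstring).  Residual = the displayed
binders: §1 side conditions, `Prop15iii`, `Prop15ii`, `CuspLabels`, `IsEtThOrigin`, `hYcl`, the junction data, `hconst`, `hD`, `m`, the Prop. 5.2 (iii)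
origin clause `hΘ`.  [claim: Mochizuki2012, status: disputed] (IUTchII §1 Prop 1.2 (ii), kurims pp.25-26) -/
theorem exists_envOfFrobenioid_frdMonoThetaEnv_ofDoubleUnderline
    (h1 : (ThetaFrobenioid.ofThetaSettingData μ hC hS h Q R' K' constEmb constEmb_injective hinvc hinvp).SectionsFactor)
    (h3 : (ThetaFrobenioid.ofThetaSettingData μ hC hS h Q R' K' constEmb constEmb_injective hinvc hinvp).OuterActionLZ)
    (hsec : (ThetaFrobenioid.ofThetaSettingData μ hC hS h Q R' K' constEmb constEmb_injective hinvc hinvp).SgpCapSection)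
    (hcs : (ThetaFrobenioid.ofThetaSettingData μ hC hS h Q R' K' constEmb constEmb_injective hinvc hinvp).SgpCupSection)
    (h8 : (ThetaFrobenioid.ofThetaSettingData μ hC hS h Q R' K' constEmb constEmb_injective hinvc hinvp).ConstantsEqNormalizer)
    (Fr : TemperedFrobenioidData (ofDoubleUnderline C μ hC hS hl hp2 hpl hζ hη)) :
    ∃ Env : EnvOfFrobenioid Fr,
      Env.env.toEtale =
          (ThetaFrobenioid.ofThetaSettingData μ hC hS h Q R' K' constEmb constEmb_injective hinvc hinvp).frdMonoThetaEnv h1 h3 hsec hcs h8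
            (ThetaFrobenioid.dkOfConnectedTemperoidData (T := C.thetaEnvData μ hC hS) h Q C.odd_lPNat R' (ContinuousMulEquiv.refl _) K'
              constEmb constEmb_injective hinvc hinvp hconst
              (ThetaFrobenioid.kxRootNModCyclotome_ofThetaSettingData_of_constantsDictionary μ hC hS h Q R' K' constEmb constEmb_injective
                hinvc hinvp hconst m hD)) ∧
        Prop12_i_indeterminacy Env.recon :=
  exists_envOfFrobenioid_of_isMonoThetaEnv
    (modelFrameOfThetaEnvData (C.rigidData μ hC hS h15 L) (SideData.ofDoubleUnderline C μ hC hS hl hp2 hpl hζ hη)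
      (t1Space_Huu C) (isClosed_ker_aug_thetaEnvData C μ hC hS)
      (ModelCyclotomes.nonempty_lDeltaQuot_rigidData_mulEquiv_zHat C μ hC hS h15 L hO hYcl hl.ne_zero))
    (modelAgreement_ofThetaEnvData (C.rigidData μ hC hS h15 L).toThetaEnvData
      (SideData.ofDoubleUnderline C μ hC hS hl hp2 hpl hζ hη))
    ((RigidData.cor218_ii_iff _).1 (C.rigidData_cor218_ii_of_origin μ hC hS h15 h15ii L hO))
    (C.rigidData_cor218_iv_fibre_of_origin μ hC hS h15 L hO hYcl) _
    (ThetaFrobenioid.frdIsMonoThetaEnv_ofThetaSettingYdd_of_originClause μ hC hS h Q R' K' constEmb constEmb_injective hinvc hinvp hconst m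
      hD hΘ h1 h3 hsec hcs h8)
    Fr

/-- **The same with NO law binder displayed** (`_canonical`): `h3 :=` abc-iut-L2-t4's theorem `outerActionLZ_of`, `h1, hsec, hcs, h8 :=` the fields of
the bundle `Facts`, itself a THEOREM at the Ÿ̲̲-junction ⟸ {`hconst`, `hD`} (abc-iut-L2-t4's `facts_ofThetaSettingYddData_of_constantsDictionary`) —
[IUTchII] Prop. 1.2 (ii) end to end for the genuine `E^Π_N` of the Tate curve's §5 data modulo EXACTLY the displayed named inputs.
[claim: Mochizuki2012, status: disputed] (IUTchII §1 Prop 1.2 (ii), kurims pp.25-26) -/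
theorem exists_envOfFrobenioid_frdMonoThetaEnv_ofDoubleUnderline_canonical
    (Fr : TemperedFrobenioidData (ofDoubleUnderline C μ hC hS hl hp2 hpl hζ hη)) :
    ∃ Env : EnvOfFrobenioid Fr,
      Env.env.toEtale =
          (ThetaFrobenioid.ofThetaSettingData μ hC hS h Q R' K' constEmb constEmb_injective hinvc hinvp).frdMonoThetaEnv
            (ThetaFrobenioid.facts_ofThetaSettingYddData_of_constantsDictionary (hD' := hD)).sectionsFactor
            (ThetaFrobenioid.ofThetaSettingData μ hC hS h Q R' K' constEmb constEmb_injective hinvc hinvp).outerActionLZ_of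
            (ThetaFrobenioid.facts_ofThetaSettingYddData_of_constantsDictionary (hD' := hD)).sgpCapSection
            (ThetaFrobenioid.facts_ofThetaSettingYddData_of_constantsDictionary (hD' := hD)).sgpCupSection
            (ThetaFrobenioid.facts_ofThetaSettingYddData_of_constantsDictionary (hD' := hD)).constantsEqNormalizer
            (ThetaFrobenioid.dkOfConnectedTemperoidData (T := C.thetaEnvData μ hC hS) h Q C.odd_lPNat R' (ContinuousMulEquiv.refl _) K'
              constEmb constEmb_injective hinvc hinvp hconst
              (ThetaFrobenioid.kxRootNModCyclotome_ofThetaSettingData_of_constantsDictionary μ hC hS h Q R' K' constEmb constEmb_injective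
                hinvc hinvp hconst m hD)) ∧
        Prop12_i_indeterminacy Env.recon :=
  exists_envOfFrobenioid_frdMonoThetaEnv_ofDoubleUnderline C μ hC hS h15 h15ii L hl hp2 hpl hζ hη hO hYcl h Q R' K' constEmb
    constEmb_injective hinvc hinvp hconst m hD hΘ _ _ _ _ _ Fr

/-- **Variant: the reference model's cocycle `s^Θ` taken FROM THE FROBENIOID** (`η :=` the transported bi-Kummer difference cocycle
`k ↦ m(s^⊔-gp_N(ρ k)·s^⊓-gp_N(ρ k)⁻¹)⁻¹` of the §5 data, a member of the collection BY the origin clause `hΘ`): the [IUTchII] §1 setting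
`ofDoubleUnderline C μ hC hS hl hp2 hpl hζ hΘ` needs no separate cocycle binder `(η, hη)` — one binder fewer than the previous theorem.
[claim: Mochizuki2012, status: disputed] (IUTchII §1 Prop 1.2 (ii), kurims pp.25-26) -/
theorem exists_envOfFrobenioid_frdMonoThetaEnv_ofDoubleUnderline_selfCocycle
    (h1 : (ThetaFrobenioid.ofThetaSettingData μ hC hS h Q R' K' constEmb constEmb_injective hinvc hinvp).SectionsFactor)
    (h3 : (ThetaFrobenioid.ofThetaSettingData μ hC hS h Q R' K' constEmb constEmb_injective hinvc hinvp).OuterActionLZ)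
    (hsec : (ThetaFrobenioid.ofThetaSettingData μ hC hS h Q R' K' constEmb constEmb_injective hinvc hinvp).SgpCapSection)
    (hcs : (ThetaFrobenioid.ofThetaSettingData μ hC hS h Q R' K' constEmb constEmb_injective hinvc hinvp).SgpCupSection)
    (h8 : (ThetaFrobenioid.ofThetaSettingData μ hC hS h Q R' K' constEmb constEmb_injective hinvc hinvp).ConstantsEqNormalizer)
    (Fr : TemperedFrobenioidData (ofDoubleUnderline C μ hC hS hl hp2 hpl hζ hΘ)) :
    ∃ Env : EnvOfFrobenioid Fr,
      Env.env.toEtale =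
          (ThetaFrobenioid.ofThetaSettingData μ hC hS h Q R' K' constEmb constEmb_injective hinvc hinvp).frdMonoThetaEnv h1 h3 hsec hcs h8
            (ThetaFrobenioid.dkOfConnectedTemperoidData (T := C.thetaEnvData μ hC hS) h Q C.odd_lPNat R' (ContinuousMulEquiv.refl _) K'
              constEmb constEmb_injective hinvc hinvp hconst
              (ThetaFrobenioid.kxRootNModCyclotome_ofThetaSettingData_of_constantsDictionary μ hC hS h Q R' K' constEmb constEmb_injective
                hinvc hinvp hconst m hD)) ∧
        Prop12_i_indeterminacy Env.recon :=
  exists_envOfFrobenioid_frdMonoThetaEnv_ofDoubleUnderline C μ hC hS h15 h15ii L hl hp2 hpl hζ hΘ hO hYcl h Q R' K' constEmb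
    constEmb_injective hinvc hinvp hconst m hD hΘ h1 h3 hsec hcs h8 Fr

/-- **The consumer's LITERAL binder-free instance** (abc-iut-w5-d177's `TemperedFrobenioidData.ofBTemp0`, "§5 data whose base category IS
`B^temp(Π^tp_{X̲̲_k})⁰` literally"): the §5 data OF THE SETTING is such data ON THE NOSE — its base category `B^temp(Π^tp_X̲̲)⁰` is
`BTemp0 (ofDoubleUnderline …).PiX` definitionally — so w5-d177's `exists_envOfFrobenioid_frdMonoThetaEnv_bTemp0` holds for it with `F`, `A`, `h218ii`,
`hfib`, `hM` ALL DISCHARGED: [IUTchII] Prop. 1.2 (ii) end to end for `𝒞 :=` the tempered Frobenioid of the Setting's §5 data, `M^Θ(𝒞) := E^Π_N`, base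
equivalence starting from the identity of `B^temp(Π^tp_{X̲̲_K})⁰`.  [claim: Mochizuki2012, status: disputed] (IUTchII §1 Prop 1.2 (ii), kurims pp.25-26) -/
theorem exists_envOfFrobenioid_frdMonoThetaEnv_ofDoubleUnderline_bTemp0
    (h1 : (ThetaFrobenioid.ofThetaSettingData μ hC hS h Q R' K' constEmb constEmb_injective hinvc hinvp).SectionsFactor)
    (h3 : (ThetaFrobenioid.ofThetaSettingData μ hC hS h Q R' K' constEmb constEmb_injective hinvc hinvp).OuterActionLZ)
    (hsec : (ThetaFrobenioid.ofThetaSettingData μ hC hS h Q R' K' constEmb constEmb_injective hinvc hinvp).SgpCapSection)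
    (hcs : (ThetaFrobenioid.ofThetaSettingData μ hC hS h Q R' K' constEmb constEmb_injective hinvc hinvp).SgpCupSection)
    (h8 : (ThetaFrobenioid.ofThetaSettingData μ hC hS h Q R' K' constEmb constEmb_injective hinvc hinvp).ConstantsEqNormalizer) :
    ∃ Env : EnvOfFrobenioid (TemperedFrobenioidData.ofBTemp0 (ofDoubleUnderline C μ hC hS hl hp2 hpl hζ hη)
        (ThetaFrobenioid.ofThetaSettingData μ hC hS h Q R' K' constEmb constEmb_injective hinvc hinvp)),
      Env.env.toEtale =
          (ThetaFrobenioid.ofThetaSettingData μ hC hS h Q R' K' constEmb constEmb_injective hinvc hinvp).frdMonoThetaEnv h1 h3 hsec hcs h8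
            (ThetaFrobenioid.dkOfConnectedTemperoidData (T := C.thetaEnvData μ hC hS) h Q C.odd_lPNat R' (ContinuousMulEquiv.refl _) K'
              constEmb constEmb_injective hinvc hinvp hconst
              (ThetaFrobenioid.kxRootNModCyclotome_ofThetaSettingData_of_constantsDictionary μ hC hS h Q R' K' constEmb constEmb_injective
                hinvc hinvp hconst m hD)) ∧
        Prop12_i_indeterminacy Env.recon :=
  exists_envOfFrobenioid_frdMonoThetaEnv_ofDoubleUnderline C μ hC hS h15 h15ii L hl hp2 hpl hζ hη hO hYcl h Q R' K' constEmb
    constEmb_injective hinvc hinvp hconst m hD hΘ h1 h3 hsec hcs h8 _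

end TateFrobenioid

end ThetaSetting

end Literature.IUT.HodgeArakelov

end

-- tree-health (abc-iut-w6-d081 g5, 2026-08-26T22:5xZ): comment-only re-land of a SKIPPED ACCEPT (committed 21:49–21:55Z; no hub olean after ≥ 55 min while the lane p90 ≈ 6 min; serial farm import probe rc 75 «remote:stale:unbuilt»);
-- declarations byte-identical to the accepted version; purpose = trigger the rebuild. No content change.
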